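import Summits.NavierStokesRegularity.NavierStokesRegularity.Theses.GaldiLiouvilleGate
import Mathlib.Analysis.SpecialFunctions.JapaneseBracket
import HarnessLib

/-!
# Crux `ParabolicGaldiLiouville` (stmt-NavierStokesRegularity-0893): the TYPE-I BRIDGE —
# X2 contains the Liouville theorem for smooth Type-I ancient flows

Support file (`--supports stmt-NavierStokesRegularity-0893`, helper; lead c3, cycle 4; theorems
only, no sorry, standard axioms). It records in Lean the cross-route coupling noted on the item by
refuter f31d8029 (route review, 2026-08-15) and used informally by the planners ("X2 contains the
exclusion of Type-I ancient flows"):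

X2 = `GaldiLiouvilleGate.ParabolicGaldiLiouville`: a smooth bounded ancient mild solution `v` of
Navier–Stokes (`ν = 1`) on `ℝ³ × (−∞,0)` with uniformly bounded enstrophy and `L⁶` slices is `≡ 0`.

* `typeIAncient_eq_zero_of_parabolicGaldiLiouville` — **X2 ⇒ smooth space–time Type-I ancient
  Liouville.** Under X2, every ancient mild solution `u` (`ν = 1`, duality form
  `IsAncientMildSolution 1 u`), jointly smooth on `(−∞,0) × ℝ³`, with the Type-I bound
  `‖u(t,x)‖ ≤ C₀/(‖x‖ + √(−t))` (`HasTypeIDecay C₀ u`, KNSS 2009 (1.6)) and the matching gradient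
  bound `|∇u(t,x)|_F² ≤ C₁/(‖x‖ + √(−t))⁴`, vanishes identically. Mechanism (the refuter's): for
  `T > 0` the time translate `v(s) = u(s − T)` is a bounded (`≤ C₀/√T`) ancient mild solution,
  smooth, with `L⁶` slices (`‖v(s,y)‖ ≤ C₀/(‖y‖ + √T) ∈ L⁶(ℝ³)`) and enstrophy bounded uniformly
  by `C₁ (min 1 √T)⁻⁴ ∫(1 + ‖y‖)⁻⁴ dy < ∞`; X2 kills `v`, i.e. `u ≡ 0` on `t < −T`, for every `T`.
  No self-similarity is used. So X2 is at least as strong as the exclusion of (space–time) Type-I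
  ancient flows in the smooth Oseen class — the NON-STEADY half of the residue left by the line's
  gates (the steady half being Galdi's problem, `galdiLiouville_of_parabolicGaldiLiouville`).
* `ParabolicGaldiLiouville_false_of_nontrivial_typeIAncient` — contrapositive: one nontrivial such
  flow refutes X2 (the form in which a proof of `¬ TypeIDSSLiouvilleConjecture`, item
  stmt-NavierStokesRegularity-0155 of route DssFarFieldSlaving, would bear on this crux, given the
  KNSS regularity of its witness).

Calculus tools (namespace `TypeIBridge`): `(‖y‖ + a) ≥ min 1 a · (1 + ‖y‖)`; `L⁶`-membership and
the `∫(1+‖y‖)⁻⁴ < ∞` bound from Mathlib's Japanese-bracket integrability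
(`integrable_one_add_norm`, `finite_integral_one_add_norm`, `finrank ℝ ℝ³ = 3 < 4, 6`).

References: H. Koch, N. Nadirashvili, G. Seregin, V. Šverák, Acta Math. 203 (2009), §1 (1.6) and
the Liouville conjecture; D. Albritton, T. Barker, J. Math. Fluid Mech. 21 (2019) no. 43, Thm 1.1
(Type-I singularity ⇔ nontrivial Type-I bounded ancient solution).
-/

noncomputable section

-- `Sub = summit`: the duplicated namespace component `NavierStokesRegularity` is deliberate.
set_option linter.dupNamespace false

namespace Summit.NavierStokesRegularity.NavierStokesRegularity.Theorems.ParabolicGaldiLiouville.Birth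

open MeasureTheory Filter Topology Set Function
open scoped ENNReal NNReal
open Literature.Analysis Literature.Analysis.FluidPDE

namespace TypeIBridge

/-- `min 1 a · (1 + ‖y‖) ≤ ‖y‖ + a` (the two weights `1 + ‖y‖` and `‖y‖ + a` are comparable;
for `a ≤ 1` this is `a‖y‖ ≤ ‖y‖`). -/
theorem min_one_mul_one_add_norm_le (a : ℝ) (y : EuclideanSpace ℝ (Fin 3)) :
    min 1 a * (1 + ‖y‖) ≤ ‖y‖ + a := by
  have hy : 0 ≤ ‖y‖ := norm_nonneg y
  rcases le_total 1 a with h | h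
  · rw [min_eq_left h]
    linarith
  · rw [min_eq_right h]
    nlinarith

/-- `∫ (1 + ‖y‖)^{−r} dy < ∞` on `ℝ³` for `r > 3` (Mathlib's Japanese bracket, `finrank ℝ ℝ³ = 3`). -/
theorem lintegral_one_add_norm_lt_top {r : ℝ} (hr : 3 < r) :
    (∫⁻ y : EuclideanSpace ℝ (Fin 3), ENNReal.ofReal ((1 + ‖y‖) ^ (-r))) < ⊤ :=
  finite_integral_one_add_norm (by simpa [finrank_euclideanSpace_fin] using hr)

/-- `y ↦ (1 + ‖y‖)^{−r}` is integrable on `ℝ³` for `r > 3`. -/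
theorem integrable_one_add_norm_rpow {r : ℝ} (hr : 3 < r) :
    Integrable (fun y : EuclideanSpace ℝ (Fin 3) => (1 + ‖y‖) ^ (-r)) volume :=
  integrable_one_add_norm (by simpa [finrank_euclideanSpace_fin] using hr)

/-- `y ↦ K (1 + ‖y‖)^{−1}` lies in `L⁶(ℝ³)`. -/
theorem memLp_six_const_mul_one_add_norm_inv (K : ℝ) :
    MemLp (fun y : EuclideanSpace ℝ (Fin 3) => K * (1 + ‖y‖) ^ (-(1 : ℝ))) 6 volume := by
  refine MemLp.const_mul ?_ K
  have hmeas : AEStronglyMeasurable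
      (fun y : EuclideanSpace ℝ (Fin 3) => (1 + ‖y‖) ^ (-(1 : ℝ))) volume :=
    Measurable.aestronglyMeasurable (by fun_prop)
  refine (integrable_norm_rpow_iff hmeas (by norm_num) (by norm_num)).1 ?_
  have h6 : ((6 : ℝ≥0∞)).toReal = 6 := by norm_num
  refine (integrable_one_add_norm_rpow (r := 6) (by norm_num)).congr (Eventually.of_forall ?_)
  intro y
  have hpos : 0 < 1 + ‖y‖ := by positivity
  simp only [h6, Real.norm_of_nonneg (Real.rpow_nonneg hpos.le _)]
  rw [← Real.rpow_mul hpos.le]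
  norm_num

/-- **`L⁶` slices from a Type-I-shaped bound.** A strongly measurable field on `ℝ³` with
`‖f y‖ ≤ C₀/(‖y‖ + a)`, `a > 0`, lies in `L⁶(ℝ³)`. -/
theorem memLp_six_of_le_div_norm_add {f : EuclideanSpace ℝ (Fin 3) → EuclideanSpace ℝ (Fin 3)}
    (hf : AEStronglyMeasurable f volume) {C₀ a : ℝ} (hC₀ : 0 ≤ C₀) (ha : 0 < a)
    (hle : ∀ y, ‖f y‖ ≤ C₀ / (‖y‖ + a)) : MemLp f 6 volume := by
  set m : ℝ := min 1 a with hm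
  have hm0 : 0 < m := lt_min one_pos ha
  refine (memLp_six_const_mul_one_add_norm_inv (C₀ / m)).of_le hf (Eventually.of_forall ?_)
  intro y
  have hpos : 0 < 1 + ‖y‖ := by positivity
  have hw : m * (1 + ‖y‖) ≤ ‖y‖ + a := min_one_mul_one_add_norm_le a y
  have hval : C₀ / m * (1 + ‖y‖) ^ (-(1 : ℝ)) = C₀ / (m * (1 + ‖y‖)) := by
    rw [Real.rpow_neg hpos.le, Real.rpow_one]
    field_simp
  rw [Real.norm_of_nonneg (by positivity), hval]
  exact (hle y).trans (div_le_div_of_nonneg_left hC₀ (by positivity) hw)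

/-- **Uniform enstrophy bound from a Type-I-shaped gradient bound.** If `0 ≤ g y ≤ C₁/(‖y‖ + a)⁴`
with `a ≥ a₀ > 0`, then `∫ g ≤ C₁ (min 1 a₀)⁻⁴ ∫ (1 + ‖y‖)⁻⁴ dy` (a bound independent of `a`). -/
theorem lintegral_le_of_le_div_norm_add_pow_four {g : EuclideanSpace ℝ (Fin 3) → ℝ}
    {C₁ a a₀ : ℝ} (hC₁ : 0 ≤ C₁) (ha₀ : 0 < a₀) (ha : a₀ ≤ a)
    (hle : ∀ y, g y ≤ C₁ / (‖y‖ + a) ^ 4) :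
    (∫⁻ y, ENNReal.ofReal (g y)) ≤ ENNReal.ofReal (C₁ / (min 1 a₀) ^ 4) *
      ∫⁻ y : EuclideanSpace ℝ (Fin 3), ENNReal.ofReal ((1 + ‖y‖) ^ (-(4 : ℝ))) := by
  set m : ℝ := min 1 a₀ with hm
  have hm0 : 0 < m := lt_min one_pos ha₀
  rw [← lintegral_const_mul' _ _ ENNReal.ofReal_ne_top]
  refine lintegral_mono fun y => ?_
  rw [← ENNReal.ofReal_mul (by positivity)]
  refine ENNReal.ofReal_le_ofReal ?_
  have hpos : 0 < 1 + ‖y‖ := by positivity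
  have hw : m * (1 + ‖y‖) ≤ ‖y‖ + a :=
    (min_one_mul_one_add_norm_le a₀ y).trans (by linarith)
  have hval : C₁ / m ^ 4 * (1 + ‖y‖) ^ (-(4 : ℝ)) = C₁ / (m * (1 + ‖y‖)) ^ 4 := by
    rw [Real.rpow_neg hpos.le, show (4 : ℝ) = ((4 : ℕ) : ℝ) by norm_num, Real.rpow_natCast]
    field_simp
  rw [hval]
  exact (hle y).trans
    (div_le_div_of_nonneg_left hC₁ (by positivity) (pow_le_pow_left₀ (by positivity) hw 4))

end TypeIBridge

/-- **X2 ⇒ the Liouville theorem for smooth space–time Type-I ancient flows.** Under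
`ParabolicGaldiLiouville`, every ancient mild solution `u` of Navier–Stokes (`ν = 1`, duality
form), jointly smooth on `(−∞,0) × ℝ³`, with `‖u(t,x)‖ ≤ C₀/(‖x‖ + √(−t))` and
`|∇u(t,x)|_F² ≤ C₁/(‖x‖ + √(−t))⁴` for all `t < 0`, `x`, vanishes identically: each time
translate `s ↦ u(s − T)`, `T > 0`, inhabits the class of X2 (bounded by `C₀/√T`, smooth, `L⁶`
slices, enstrophy `≤ C₁ (min 1 √T)⁻⁴ ∫(1+‖y‖)⁻⁴`). -/
theorem typeIAncient_eq_zero_of_parabolicGaldiLiouville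
    (hX2 : Theses.GaldiLiouvilleGate.ParabolicGaldiLiouville)
    {u : ℝ → EuclideanSpace ℝ (Fin 3) → EuclideanSpace ℝ (Fin 3)}
    (hu : IsAncientMildSolution 1 u)
    (hsm : ContDiffOn ℝ (⊤ : ℕ∞) (uncurry u) (Iio 0 ×ˢ univ))
    {C₀ : ℝ} (h0 : HasTypeIDecay C₀ u)
    {C₁ : ℝ} (h1 : ∀ t < 0, ∀ x, frobeniusNormSq (fderiv ℝ (u t) x) ≤ C₁ / (‖x‖ + Real.sqrt (-t)) ^ 4) :
    ∀ t < 0, ∀ x, u t x = 0 := by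
  -- signs of the constants
  have hC₀ : 0 ≤ C₀ := by
    have h := (norm_nonneg _).trans (h0 (-1) (by norm_num) 0)
    simpa using h
  have hC₁ : 0 ≤ C₁ := by
    have h := (frobeniusNormSq_nonneg _).trans (h1 (-1) (by norm_num) 0)
    simpa using h
  -- the finite weight integral
  have hI4 : (∫⁻ y : EuclideanSpace ℝ (Fin 3), ENNReal.ofReal ((1 + ‖y‖) ^ (-(4 : ℝ)))) < ⊤ :=
    TypeIBridge.lintegral_one_add_norm_lt_top (by norm_num)
  intro t ht x
  -- translate by `T = −t/2 > 0`
  set T : ℝ := -t / 2 with hT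
  have hT0 : 0 < T := by rw [hT]; linarith
  set v : ℝ → EuclideanSpace ℝ (Fin 3) → EuclideanSpace ℝ (Fin 3) := fun s => u (s + -T) with hv
  have hsT : ∀ s < (0 : ℝ), s + -T < 0 := fun s hs => by linarith
  have hsqrt : ∀ s < (0 : ℝ), Real.sqrt T ≤ Real.sqrt (-(s + -T)) := fun s hs =>
    Real.sqrt_le_sqrt (by linarith)
  have hsqT : 0 < Real.sqrt T := Real.sqrt_pos.2 hT0
  -- (1) bounded ancient mild
  have hv1 : IsBoundedAncientMildSolution 1 v := by
    refine ⟨hu.time_translate (by linarith), C₀ / Real.sqrt T, fun s hs y => ?_⟩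
    calc ‖v s y‖ = ‖u (s + -T) y‖ := rfl
      _ ≤ C₀ / (‖y‖ + Real.sqrt (-(s + -T))) := h0 _ (hsT s hs) y
      _ ≤ C₀ / Real.sqrt T :=
          div_le_div_of_nonneg_left hC₀ hsqT
            ((hsqrt s hs).trans (le_add_of_nonneg_left (norm_nonneg y)))
  -- (2) smooth
  have hv2 : ContDiffOn ℝ (⊤ : ℕ∞) (uncurry v) (Iio 0 ×ˢ univ) := by
    have hmap : ContDiff ℝ (⊤ : ℕ∞)
        (fun p : ℝ × EuclideanSpace ℝ (Fin 3) => (p.1 + -T, p.2)) :=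
      (contDiff_fst.add contDiff_const).prodMk contDiff_snd
    refine hsm.comp hmap.contDiffOn ?_
    rintro ⟨s, y⟩ ⟨hs, -⟩
    exact ⟨hsT s hs, mem_univ _⟩
  -- (3) uniformly bounded enstrophy
  have hv3 : ∃ C : NNReal, ∀ s < 0,
      ∫⁻ y, ENNReal.ofReal (frobeniusNormSq (fderiv ℝ (v s) y)) ≤ C := by
    set K : ℝ≥0∞ := ENNReal.ofReal (C₁ / (min 1 (Real.sqrt T)) ^ 4) *
      ∫⁻ y : EuclideanSpace ℝ (Fin 3), ENNReal.ofReal ((1 + ‖y‖) ^ (-(4 : ℝ))) with hK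
    have hKtop : K ≠ ⊤ := ENNReal.mul_ne_top ENNReal.ofReal_ne_top hI4.ne
    refine ⟨K.toNNReal, fun s hs => ?_⟩
    rw [ENNReal.coe_toNNReal hKtop]
    exact TypeIBridge.lintegral_le_of_le_div_norm_add_pow_four hC₁ hsqT (hsqrt s hs)
      (fun y => h1 _ (hsT s hs) y)
  -- (4) `L⁶` slices
  have hv4 : ∀ s < 0, MemLp (v s) 6 volume := by
    intro s hs
    have hcont : Continuous (v s) :=
      hv2.continuousOn.comp_continuous (continuous_const.prodMk continuous_id)
        fun y => ⟨hs, mem_univ y⟩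
    exact TypeIBridge.memLp_six_of_le_div_norm_add hcont.aestronglyMeasurable hC₀
      (hsqT.trans_le (hsqrt s hs)) (fun y => h0 _ (hsT s hs) y)
  -- X2 kills the translate; read off `u t x = v (t/2) x`
  have hzero := hX2 v hv1 hv2 hv3 hv4 (t / 2) (by linarith) x
  have htime : t / 2 + -T = t := by rw [hT]; ring
  simpa only [hv, htime] using hzero

/-- **Contrapositive: one nontrivial smooth space–time Type-I ancient flow refutes X2** (the
form in which a Type-I blow-up profile — Albritton–Barker 2019 Thm 1.1 — or a negative answer to
the Type-I DSS Liouville problem would bear on this crux, given the KNSS regularity and gradient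
decay of the witness). -/
theorem ParabolicGaldiLiouville_false_of_nontrivial_typeIAncient
    (h : ∃ (u : ℝ → EuclideanSpace ℝ (Fin 3) → EuclideanSpace ℝ (Fin 3)) (C₀ C₁ : ℝ),
      IsAncientMildSolution 1 u ∧
      ContDiffOn ℝ (⊤ : ℕ∞) (uncurry u) (Iio 0 ×ˢ univ) ∧
      HasTypeIDecay C₀ u ∧
      (∀ t < 0, ∀ x, frobeniusNormSq (fderiv ℝ (u t) x) ≤ C₁ / (‖x‖ + Real.sqrt (-t)) ^ 4) ∧
      ∃ t < 0, ∃ x, u t x ≠ 0) :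
    ¬ Theses.GaldiLiouvilleGate.ParabolicGaldiLiouville := by
  rintro hX2
  obtain ⟨u, C₀, C₁, hu, hsm, h0, h1, t, ht, x, hx⟩ := h
  exact hx (typeIAncient_eq_zero_of_parabolicGaldiLiouville hX2 hu hsm h0 h1 t ht x)

end Summit.NavierStokesRegularity.NavierStokesRegularity.Theorems.ParabolicGaldiLiouville.Birth

end
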